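import Literature.NumberTheory.ComplexMultiplication.TateHalfTransferOrbitsGalois
import Literature.NumberTheory.ComplexMultiplication.ReflexNormArtinMap
import HarnessLib

/-!
# `art_E(N_Φ(a)) = F_Φ(σ)`: Tate's half transfer on `Γ_{E*}` is the Shimura–Taniyama reciprocity homomorphism of the reflex norm
# (Milne, *The fundamental theorem of complex multiplication*, arXiv:0705.3446, §4.2, proof of Proposition 4.9)

Topic `NumberTheory/ComplexMultiplication`; namespace `Literature.NumberTheory.ComplexMultiplication`.  Lane
`lit-hodgefound` (Track 2, Layer A3 skeleton seat `skel-3`, row A3-G46 FILE 4: «Thus `art_E(N_Φ(a)) = ∏ art_E(b_j) = ∏ F_j(σ)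
= F_Φ(σ)`» — the sum over the orbits, assembling FILE 1 `…/TateHalfTransferOrbits` (`F_Φ = ∏ F_j`, `F_j` a transfer), FILE 2
`…/ReflexNormIdelesOrbits` (`N_Φ(a) = ∏ b_j` on idèles) and FILE 3 `…/TateHalfTransferOrbitsGalois` (`F_j = res^ab ∘ Ver`)
through the functorialities of the Artin map of rows A3-G39 (`res^ab [y, M] = [Nm y, K]`) and A3-G44 (`Ver [x, k] = [con x, M]`);
FILE 5 `…/TaniyamaElementReflexNorm` is Prop. 4.9 itself.)  Definitions with bodies (`absClosureToComplex`, `orbitConjEmb`,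
`orbitEmbSet`, `orbitVerlagerungProd`) and theorems, all proved; no named fact, no global instance (D-0026, net debt 0).

## The print, verbatim

J. S. Milne, *The fundamental theorem of complex multiplication*, arXiv:0705.3446 [Milne2007FundamentalCM], §4.2 (held
`paper:arxiv-0705.3446` p0020 L38–L115):

> «Let `E*` be the reflex field for `(E,Φ)`, so that `Aut(ℂ/E*) = {σ ∈ Aut(ℂ) | σΦ = Φ}`. Then `Φ Aut(ℂ/E) = ⋃_{φ∈Φ} φ·Aut(ℂ/E)`
> is stable under the left action of `Aut(ℂ/E*)` […] PROOF [of Prop. 4.9]. Partition `Φ` into orbits, `Φ = ∪_j Φ_j`, for the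
> left action of `Aut(ℂ/E*)`. […] Thus `N_Φ(a) = ∏ b_j`, with `b_j = Nm_{L_j/E}(σ_j⁻¹(a))`.  Let
> `F_j(σ) = ∏_{φ∈Φ_j} w_{σφ}⁻¹ σ w_φ (mod Aut(ℂ/E^ab))`.  We begin by showing that `F_j(σ) = art_E(b_j)`. The basic properties
> of Artin's reciprocity law show that [the diagram] commutes. Therefore `art_E(b_j)` is the image of `art_{E*}(a)` by the three
> maps in the bottom row of the diagram. […] `F_j(σ) = […] = σ_j⁻¹V(σ)σ_j mod Aut(ℂ/E^ab)`.  Thus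
> `art_E(N_Φ(a)) = ∏ art_E(b_j) = ∏ F_j(σ) = F_Φ(σ)`.»

## Reading (the tree's vocabulary, as in FILE 3)

`K` a CM field, `Φ : CMType K` (embeddings `K → ℂ`), `E* = traceField Φ ⊆ k ⊂ ℂ` a number field (Milne's statement is
`k = E*`), `X = Γ_ℚ ⧸ H`, `H = res(Γ_K)`, `S = res_ℚ^k(Γ_k) ≤ Γ_ℚ`.  Milne's `Hom(E, ℂ)` is read on `X` along an embedding
`j : Q̄ → ℂ` COMPATIBLE WITH `k ⊂ ℂ` (`hj : j ∘ e_{ℚ,k} = (k ⊂ ℂ)`, so that `S` corresponds to `Aut(ℂ/k)`): `Θ = embOfCoset K j :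
X ≃ Hom(K, ℂ)` (`…/TateHalfTransferCM`), and the CM type on `X` is `Ψ = Θ⁻¹(Φ)`; for a complex conjugation `c ∈ Γ_ℚ` with
`j(c•y) = \overline{j y}` it is a CM type for `c` and `F_Ψ = tateHalfTransfer K c Ψ : Γ_ℚ → Γ_K^ab` is Tate's half transfer
(row A3-G45).  The orbits: p27's representatives `r ∈ orbitReps … k` of the `Aut(ℂ/k)`-orbits on `Φ`, `M_r = k·r(K)`,
`g_r = orbitGaloisRep K k r ∈ Γ_ℚ` (FILE 3).  The tree's Artin maps are `[·, F] = art_F⁻¹` (Milne's `art = rec⁻¹`), which does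
not affect the statement `η = F_Ψ ∘ res` below (both sides are homomorphisms).

## What is proved

* §1 **The `Γ_k`-orbits on `Ψ` ARE the `Aut(ℂ/k)`-orbits on `Φ`** («`Φ Aut(ℂ/E)` is stable under the left action of
  `Aut(ℂ/E*)`», «Partition `Φ` into orbits»): with `j' : k̄ → ℂ` the `k`-embedding induced by `j` (`absClosureToComplex`) and
  `σ_δ = j' ∘ δ ∘ e_{k,M} : M_r → ℂ` (`orbitConjEmb`), `Θ(res δ • g_rH) = σ_δ ∘ r` (`embOfCoset_absGaloisRestrict_smul_mk_orbitGaloisRep`),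
  so `Θ(S • g_rH) ⊆ {σ ∘ r | σ : M_r →_k ℂ}` = p27's `conjugatesOver k r`; both sides have `[M_r : k]` elements
  (`[S : Stab_S(g_rH)] = [Γ_k : Γ_{M_r}] = [M_r : k]` by FILE 3's `stabilizer_orbitGaloisRep_eq_comap` and
  `nat_card_quotient_range_absGaloisRestrict`; `card_conjugatesOver`), hence **`Θ(S • g_rH) = conjugatesOver k r`**
  (`image_orbit_eq_orbitEmbSet`), **`Ψ = ⊔_r S • g_rH`** (`preimage_cmType_eq_iUnion_orbit`, from
  `Φ = ⊔_r conjugatesOver k r`, `conjugatesOver_eq_filter`), pairwise disjoint (`pairwise_disjoint_orbit`), and `Ψ` is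
  `S`-stable (`absGaloisRestrict_smul_preimage_cmType`).
* §2 **`F_Ψ(res σ) = ∏_r res^ab_{K,M_r}(Ver_{M_r/k}[σ])` for `σ ∈ Γ_k`** (`tateHalfTransfer_absGaloisRestrict_eq_prod`): FILE 1's
  `halfTransfer_eq_halfTransferWith_of_smul_eq` + `halfTransferWith_eq_prod_transfer` over the decomposition of §1, then FILE
  3's `transfer_orbitTransferHom_eq` orbit by orbit — «`∏ F_j(σ) = F_Φ(σ)`» with «`F_j(σ) = σ_j⁻¹V(σ)σ_j`».
* §3 **The homomorphism `∏_r res^ab_{K,M_r} ∘ Ver_{M_r/k} : Γ_k^ab → Γ_K^ab` IS Milne's `η` of Lemma 9.8** (row A3-G39's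
  `reflexNormArtinHom K Φ k`, the unique `η` with `η [s, k] = [N_{k,Φ} s, K]`): on `[x, k]` it gives
  `∏_r res^ab_r(Ver_r [x, k]) = ∏_r res^ab_r [con_r x, M_r] = ∏_r [Nm_{M_r/K}(con_r x), K] = [∏_r Nm_r(con_r x), K] = [N_{k,Φ} x, K]`
  (A3-G44 `verlagerung_ideleArtinMap`, A3-G39 `absGaloisRestrictAb_ideleArtinMap`, FILE 2
  `reflexNormIdele_eq_prod_ideleRelNorm_orbitField`) — «`art_E(b_j)` is the image of `art_{E*}(a)` by the three maps in the
  bottom row» and «`N_Φ(a) = ∏ b_j`» (`orbitVerlagerungProd_ideleArtinMap`, `orbitVerlagerungProd_eq_reflexNormArtinHom`).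
* §4 **THE THEOREM `tateHalfTransfer_absGaloisRestrict`: `F_Ψ(res σ) = η_{k,Φ}[σ]` for every `σ ∈ Γ_k`** — Tate's half transfer
  restricted to `Γ_k ≤ Γ_{E*}` (`k ⊇ E*`) is the reciprocity homomorphism of the reflex norm —, `F_Ψ(res σ⁻¹) = F_Ψ(res σ)⁻¹`,
  and its idelic form **`[N_{k,Φ}(s), K] = F_Ψ(res σ)` whenever `[s, k] = [σ]`** (`ideleArtinMap_reflexNormIdele_eq_tateHalfTransfer`) — Milne's
  «`art_E(N_Φ(a)) = F_Φ(σ)`» (for `art_{E*}(a) = σ|E*^ab`; with `art = [·]⁻¹` on both sides the two sign conventions cancel).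

NOT HERE: Prop. 4.9 itself (`N_Φ(a) ∈ f_Φ(σ)`, FILE 5); the existence of a pair `(j, c)` compatible with a given `k ⊂ ℂ`
(FILE 5); `k ⊉ E*`.

## References

* J. S. Milne, *The fundamental theorem of complex multiplication*, arXiv:0705.3446 (2007), §4.2, Prop. 4.9 (proof).
  [Milne2007FundamentalCM]
* J. S. Milne, *Complex Multiplication* (course notes), Ch. II §9 Lemma 9.8 (the homomorphism `η`). [MilneCM2006]
* J. Neukirch, *Algebraic Number Theory*, Springer 1999, Ch. IV §5 (5.8), (5.9); Ch. VI §5 (5.2). [NeukirchANT1999]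
* J. S. Milne, *Fields and Galois Theory* (v5.10, 2022), Ch. 7 (the absolute Galois group). [MilneFT2022]

## Provenance

Lane `lit-hodgefound`, seat `literature-prover-lit-hodgefound-skel-3-g30-0` (row A3-G46, FILE 4).
-/

set_option autoImplicit false

noncomputable section

open scoped Pointwise IntermediateField

namespace Literature.NumberTheory.ComplexMultiplication

open Field NumberField
open Literature.NumberTheory.GaloisRepresentations Literature.NumberTheory.NumberFields
open Literature.NumberTheory.AdelicBaseChange (ideleRelNorm)
open Literature.AlgebraicGeometry.GaoUllmo2025 (Emb)
open Literature.AlgebraicGeometry.Motives (CMType)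
open HalfTransfer

attribute [local instance] orbitFieldAlgebra isScalarTower_orbitField moduleFinite_orbitField numberField_orbitField

/- As in FILE 3: the subgroup `S = res(Γ_k)` acts on `Γ_ℚ ⧸ H` through the generic restricted action. -/
attribute [-instance] MulAction.mulLeftCosetsCompSubtypeVal

/-! ### §1. The `Γ_k`-orbits on `Ψ = Θ⁻¹(Φ)` are the `Aut(ℂ/k)`-orbits on `Φ` -/

section Embeddings

variable (k : IntermediateField ℚ ℂ) [NumberField k] {j : AlgebraicClosure ℚ →+* ℂ}
  (hj : ∀ x : k, j (absEmbedding ℚ k x) = (x : ℂ))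

/-- `res_ℚ^k δ • ι_{ℚ,k}⁻¹ y = ι_{ℚ,k}⁻¹ (δ • y)`: the inverse identification `k̄ ≅ Q̄` is `Γ_k`-equivariant (the tree's
`absGaloisRestrict_apply_smul` read backwards). [cite: MilneFT2022, Ch. 7 (the absolute Galois group: restriction `Gal(Ω/E) → Gal(Ω/F)` along `F̄ ≅ Ē`)] -/
theorem absGaloisRestrict_smul_absClosureEquiv_symm (δ : absoluteGaloisGroup k) (y : AlgebraicClosure k) :
    absGaloisRestrict ℚ k δ • (absClosureEquiv ℚ k).symm y = (absClosureEquiv ℚ k).symm (δ • y) := by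
  apply (absClosureEmbedding ℚ k).toRingHom.injective
  change absClosureEmbedding ℚ k _ = absClosureEmbedding ℚ k _
  rw [absGaloisRestrict_apply_smul, absClosureEmbedding_absClosureEquiv_symm, absClosureEmbedding_absClosureEquiv_symm]

/-- **`j' : k̄ → ℂ`, the `k`-embedding of `k̄ ≅ Q̄` into `ℂ` induced by `j`** (a `k`-algebra map because `j ∘ e_{ℚ,k}` is the
inclusion `k ⊂ ℂ`).  Through it the `Γ_k`-side and Milne's `Aut(ℂ/k)`-side correspond.
[cite: Milne2007FundamentalCM, §4.2 Lemma 4.5 («extend it to an embedding i : E^ab ↪ ℂ», «we can suppose E ⊂ ℂ»)] -/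
def absClosureToComplex : AlgebraicClosure k →ₐ[k] ℂ where
  toRingHom := j.comp (((absClosureEquiv ℚ k).symm : AlgebraicClosure k ≃ₐ[ℚ] AlgebraicClosure ℚ) :
    AlgebraicClosure k →+* AlgebraicClosure ℚ)
  commutes' x := by
    change j ((absClosureEquiv ℚ k).symm (algebraMap k (AlgebraicClosure k) x)) = (x : ℂ)
    exact hj x

/-- Unfolding. [cite: Milne2007FundamentalCM, §4.2 Lemma 4.5] -/
theorem absClosureToComplex_apply (y : AlgebraicClosure k) :
    absClosureToComplex k hj y = j ((absClosureEquiv ℚ k).symm y) := rfl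

variable (K : Type) [Field K] [NumberField K]

/-- **`σ_δ = j' ∘ δ ∘ e_{k,M} : M = k·φ(K) → ℂ`**, the `k`-embedding of the orbit field attached to `δ ∈ Γ_k` — under `Θ` the
element `res δ • g_φH` of the `Γ_k`-orbit is `σ_δ ∘ φ ∈ Hom(K, ℂ)` (`embOfCoset_absGaloisRestrict_smul_mk_orbitGaloisRep`).
[cite: Milne2007FundamentalCM, §4.2 Prop. 4.9 (proof: «(Hom_E(L_j,ℂ) ∘ σ_j⁻¹)Aut(ℂ/E*)»)] -/
def orbitConjEmb (φ : Emb K) (δ : absoluteGaloisGroup k) : orbitField k φ →ₐ[k] ℂ :=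
  (absClosureToComplex k hj).comp
    ((((absoluteGaloisGroup.toAlgEquiv k δ) : AlgebraicClosure k ≃ₐ[k] AlgebraicClosure k) :
        AlgebraicClosure k →ₐ[k] AlgebraicClosure k).comp (absEmbedding k (orbitField k φ)))

/-- Unfolding: `σ_δ m = j(ι_{ℚ,k}⁻¹(δ • e_{k,M} m))`. [cite: Milne2007FundamentalCM, §4.2 Prop. 4.9 (proof)] -/
theorem orbitConjEmb_apply (φ : Emb K) (δ : absoluteGaloisGroup k) (m : orbitField k φ) :
    orbitConjEmb k hj K φ δ m = j ((absClosureEquiv ℚ k).symm (δ • absEmbedding k (orbitField k φ) m)) := rfl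

/-- **`Θ(res δ • g_φH) = σ_δ ∘ φ`**: along `Θ = embOfCoset K j`, the point `res δ • g_φH` of the `Γ_k`-orbit of `g_φH` is the
`k`-conjugate `σ_δ ∘ φ` of `φ` («`Aut(ℂ/E)Φ_j⁻¹ = (Hom_E(L_j,ℂ) ∘ σ_j⁻¹)Aut(ℂ/E*)`», read through `Θ`).
[cite: Milne2007FundamentalCM, §4.2 Prop. 4.9 (proof)] -/
theorem embOfCoset_absGaloisRestrict_smul_mk_orbitGaloisRep (φ : Emb K) (δ : absoluteGaloisGroup k) :
    embOfCoset K j (absGaloisRestrict ℚ k δ • ((orbitGaloisRep K k φ : absoluteGaloisGroup ℚ) :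
        absoluteGaloisGroup ℚ ⧸ (absGaloisRestrict ℚ K).range)) =
      (embOfAlgHom k φ (orbitConjEmb k hj K φ δ) : K →+* ℂ) := by
  rw [MulAction.Quotient.smul_mk, smul_eq_mul, embOfCoset_mk]
  refine RingHom.ext fun a => ?_
  rw [embOfElement_apply, mul_smul, orbitGaloisRep_smul_absEmbedding, orbitEmbedding_apply,
    absGaloisRestrict_smul_absClosureEquiv_symm]
  rfl

/-- **The `k`-conjugates of `φ` as ring embeddings**: `{σ ∘ φ | σ : k·φ(K) →_k ℂ} ⊆ Hom(K, ℂ)` — p27's `conjugatesOver k φ`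
(= the `Aut(ℂ/k)`-orbit of `φ`, `coe_conjugatesOver`) coerced to ring homomorphisms; Milne's orbit `Φ_j`.
[cite: Milne2007FundamentalCM, §4.2 Prop. 4.9 (proof: «Partition Φ into orbits, Φ = ∪_j Φ_j»)] -/
def orbitEmbSet (φ : Emb K) : Set (K →+* ℂ) :=
  (fun χ : Emb K => (χ : K →+* ℂ)) '' (conjugatesOver k φ : Set (Emb K))

omit [NumberField k] in
/-- `ψ ∈ orbitEmbSet φ ↔ ψ.toRatAlgHom ∈ conjugatesOver k φ`. [cite: Milne2007FundamentalCM, §4.2 Prop. 4.9 (proof)] -/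
theorem mem_orbitEmbSet_iff (φ : Emb K) (ψ : K →+* ℂ) :
    ψ ∈ orbitEmbSet k K φ ↔ ψ.toRatAlgHom ∈ conjugatesOver k φ := by
  constructor
  · rintro ⟨χ, hχ, rfl⟩
    rwa [AlgHom.toRingHom_toRatAlgHom]
  · intro h
    exact ⟨ψ.toRatAlgHom, h, RingHom.toRatAlgHom_toRingHom ψ⟩

omit [NumberField k] in
/-- `orbitEmbSet φ` has `[k·φ(K) : k]` elements (p27's `card_conjugatesOver`). [cite: MilneCM2006, Ch. I §1 Prop. 1.21 (proof)] -/
theorem ncard_orbitEmbSet (φ : Emb K) : (orbitEmbSet k K φ).ncard = Module.finrank k (orbitField k φ) := by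
  rw [orbitEmbSet, Set.ncard_image_of_injective _ AlgHom.coe_ringHom_injective, Set.ncard_coe_finset,
    card_conjugatesOver]

include hj in
/-- **`Θ(S • g_φH) ⊆ {σ ∘ φ}`**: the image of the `Γ_k`-orbit consists of `k`-conjugates of `φ`.
[cite: Milne2007FundamentalCM, §4.2 Prop. 4.9 (proof)] -/
theorem image_orbit_subset_orbitEmbSet (φ : Emb K) :
    embOfCoset K j '' MulAction.orbit (absGaloisRestrict ℚ k).range
        ((orbitGaloisRep K k φ : absoluteGaloisGroup ℚ) : absoluteGaloisGroup ℚ ⧸ (absGaloisRestrict ℚ K).range) ⊆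
      orbitEmbSet k K φ := by
  classical
  rintro _ ⟨x, ⟨u, rfl⟩, rfl⟩
  obtain ⟨δ, hδ⟩ : ∃ δ : absoluteGaloisGroup k, absGaloisRestrict ℚ k δ = (u : absoluteGaloisGroup ℚ) := u.2
  refine ⟨embOfAlgHom k φ (orbitConjEmb k hj K φ δ), ?_, ?_⟩
  · rw [Finset.mem_coe, conjugatesOver]
    exact Finset.mem_image.2 ⟨_, Finset.mem_univ _, rfl⟩
  · change _ = embOfCoset K j ((u : absoluteGaloisGroup ℚ) • ((orbitGaloisRep K k φ : absoluteGaloisGroup ℚ) :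
        absoluteGaloisGroup ℚ ⧸ (absGaloisRestrict ℚ K).range))
    rw [← hδ, embOfCoset_absGaloisRestrict_smul_mk_orbitGaloisRep k hj K φ δ]

/-- **`|S • g_φH| = [k·φ(K) : k]`**: orbit–stabiliser, the stabiliser is `Γ_M` (FILE 3) of index `[M : k]` in `Γ_k`.
[cite: Milne2007FundamentalCM, §4.2 Prop. 4.9 (proof: «a set of coset representatives for σ_jAut(ℂ/L_j)σ_j⁻¹ in Aut(ℂ/E*)»)] -/
theorem natCard_orbit_orbitGaloisRep (φ : Emb K) :
    Nat.card (MulAction.orbit (absGaloisRestrict ℚ k).range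
        ((orbitGaloisRep K k φ : absoluteGaloisGroup ℚ) : absoluteGaloisGroup ℚ ⧸ (absGaloisRestrict ℚ K).range)) =
      Module.finrank k (orbitField k φ) := by
  rw [Nat.card_congr (MulAction.orbitEquivQuotientStabilizer (absGaloisRestrict ℚ k).range _), ← Subgroup.index,
    stabilizer_orbitGaloisRep_eq_comap K k φ, Subgroup.index_comap_of_surjective, Subgroup.index,
    nat_card_quotient_range_absGaloisRestrict]
  exact (MonoidHom.ofInjective (toMonoidHom_absGaloisRestrict_rat_injective k)).symm.surjective

include hj in
/-- **`Θ(S • g_φH) = {σ ∘ φ}` — THE `Γ_k`-ORBIT OF `g_φH` IS THE `Aut(ℂ/k)`-ORBIT OF `φ`** (inclusion of finite sets of the same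
size `[k·φ(K) : k]`). [cite: Milne2007FundamentalCM, §4.2 Prop. 4.9 (proof: «Partition Φ into orbits … for the left action of Aut(ℂ/E*)»)] -/
theorem image_orbit_eq_orbitEmbSet (φ : Emb K) :
    embOfCoset K j '' MulAction.orbit (absGaloisRestrict ℚ k).range
        ((orbitGaloisRep K k φ : absoluteGaloisGroup ℚ) : absoluteGaloisGroup ℚ ⧸ (absGaloisRestrict ℚ K).range) =
      orbitEmbSet k K φ := by
  refine Set.eq_of_subset_of_ncard_le (image_orbit_subset_orbitEmbSet k hj K φ) (le_of_eq ?_) (Set.toFinite _)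
  rw [ncard_orbitEmbSet, Set.ncard_image_of_injective _ (embOfCoset_injective K j), ← Nat.card_coe_set_eq,
    natCard_orbit_orbitGaloisRep]

include hj in
/-- `Θ⁻¹{σ ∘ φ} = S • g_φH`. [cite: Milne2007FundamentalCM, §4.2 Prop. 4.9 (proof)] -/
theorem preimage_orbitEmbSet_eq_orbit (φ : Emb K) :
    embOfCoset K j ⁻¹' orbitEmbSet k K φ = MulAction.orbit (absGaloisRestrict ℚ k).range
        ((orbitGaloisRep K k φ : absoluteGaloisGroup ℚ) : absoluteGaloisGroup ℚ ⧸ (absGaloisRestrict ℚ K).range) := by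
  rw [← image_orbit_eq_orbitEmbSet k hj K φ, Set.preimage_image_eq _ (embOfCoset_injective K j)]

variable (Φ : CMType K)

/-- **`Φ = ⊔_r {σ ∘ r}` over p27's orbit representatives** (for `k ⊇ E*` the `Aut(ℂ/k)`-orbits meeting `Φ` lie in `Φ` and are
the `conjugatesOver k r`, `conjugatesOver_eq_filter`). [cite: Milne2007FundamentalCM, §4.2 Prop. 4.9 (proof: «Partition Φ into orbits, Φ = ∪_j Φ_j»)] -/
theorem cmType_eq_iUnion_orbitEmbSet (hk : traceField Φ ≤ k) :
    Φ.1 = ⋃ r : ↥(orbitReps (cmTypeEquivCMTypeOn K Φ) k), orbitEmbSet k K (r : Emb K) := by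
  classical
  have hk' : reflexFieldOn (cmTypeEquivCMTypeOn K Φ) ≤ k := by rwa [reflexFieldOn_cmTypeEquivCMTypeOn]
  ext ψ
  rw [Set.mem_iUnion]
  constructor
  · intro hψ
    have hψ' : ψ.toRatAlgHom ∈ (cmTypeEquivCMTypeOn K Φ).Φ := (toRatAlgHom_mem_cmTypeEquivCMTypeOn_iff K Φ ψ).2 hψ
    have hr : orbitRep k ψ.toRatAlgHom ∈ orbitReps (cmTypeEquivCMTypeOn K Φ) k := by
      rw [orbitReps]
      exact Finset.mem_image.2 ⟨_, hψ', rfl⟩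
    refine ⟨⟨orbitRep k ψ.toRatAlgHom, hr⟩, (mem_orbitEmbSet_iff k K _ ψ).2 ?_⟩
    rw [conjugatesOver_eq_filter (cmTypeEquivCMTypeOn K Φ) k hk' hr, Finset.mem_filter]
    exact ⟨hψ', rfl⟩
  · rintro ⟨r, hr⟩
    rw [mem_orbitEmbSet_iff, conjugatesOver_eq_filter (cmTypeEquivCMTypeOn K Φ) k hk' r.2, Finset.mem_filter] at hr
    exact (toRatAlgHom_mem_cmTypeEquivCMTypeOn_iff K Φ ψ).1 hr.1

include hj in
/-- **`Ψ = Θ⁻¹(Φ) = ⊔_r S • g_rH`: the CM type read on `Γ_ℚ ⧸ Γ_K` is the disjoint union of the `Γ_k`-orbits of the points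
`g_rH`** («Partition `Φ` into orbits … for the left action of `Aut(ℂ/E*)`», transported to `Γ_ℚ ⧸ Γ_K`).
[cite: Milne2007FundamentalCM, §4.2 Prop. 4.9 (proof)] -/
theorem preimage_cmType_eq_iUnion_orbit (hk : traceField Φ ≤ k) :
    embOfCoset K j ⁻¹' Φ.1 = ⋃ r : ↥(orbitReps (cmTypeEquivCMTypeOn K Φ) k),
      MulAction.orbit (absGaloisRestrict ℚ k).range
        ((orbitGaloisRep K k (r : Emb K) : absoluteGaloisGroup ℚ) : absoluteGaloisGroup ℚ ⧸ (absGaloisRestrict ℚ K).range) := by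
  rw [cmType_eq_iUnion_orbitEmbSet k K Φ hk, Set.preimage_iUnion]
  exact Set.iUnion_congr fun r => preimage_orbitEmbSet_eq_orbit k hj K (r : Emb K)

include hj in
/-- **The orbits of distinct representatives are disjoint.** [cite: Milne2007FundamentalCM, §4.2 Prop. 4.9 (proof: «Φ = ∪_j Φ_j»)] -/
theorem pairwise_disjoint_orbit (hk : traceField Φ ≤ k) :
    Pairwise fun r r' : ↥(orbitReps (cmTypeEquivCMTypeOn K Φ) k) =>
      Disjoint
        (MulAction.orbit (absGaloisRestrict ℚ k).range
          ((orbitGaloisRep K k (r : Emb K) : absoluteGaloisGroup ℚ) : absoluteGaloisGroup ℚ ⧸ (absGaloisRestrict ℚ K).range))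
        (MulAction.orbit (absGaloisRestrict ℚ k).range
          ((orbitGaloisRep K k (r' : Emb K) : absoluteGaloisGroup ℚ) :
            absoluteGaloisGroup ℚ ⧸ (absGaloisRestrict ℚ K).range)) := by
  classical
  have hk' : reflexFieldOn (cmTypeEquivCMTypeOn K Φ) ≤ k := by rwa [reflexFieldOn_cmTypeEquivCMTypeOn]
  intro r r' hne
  by_contra h
  obtain ⟨x, hx, hx'⟩ := Set.not_disjoint_iff.1 h
  -- the two orbits coincide, hence so do the sets of `k`-conjugates, hence the representatives
  have horb : MulAction.orbit (absGaloisRestrict ℚ k).range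
        ((orbitGaloisRep K k (r : Emb K) : absoluteGaloisGroup ℚ) : absoluteGaloisGroup ℚ ⧸ (absGaloisRestrict ℚ K).range) =
      MulAction.orbit (absGaloisRestrict ℚ k).range
        ((orbitGaloisRep K k (r' : Emb K) : absoluteGaloisGroup ℚ) :
          absoluteGaloisGroup ℚ ⧸ (absGaloisRestrict ℚ K).range) := by
    rw [← MulAction.orbit_eq_iff.2 hx, ← MulAction.orbit_eq_iff.2 hx']
  have hset : orbitEmbSet k K (r : Emb K) = orbitEmbSet k K (r' : Emb K) := by
    rw [← image_orbit_eq_orbitEmbSet k hj K, ← image_orbit_eq_orbitEmbSet k hj K, horb]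
  have hconj : conjugatesOver k (r' : Emb K) = conjugatesOver k (r : Emb K) := by
    apply Finset.coe_injective
    exact (Set.image_injective.2 AlgHom.coe_ringHom_injective) hset.symm
  have hmem : (r' : Emb K) ∈ conjugatesOver k (r : Emb K) := hconj ▸ self_mem_conjugatesOver k (r' : Emb K)
  rw [conjugatesOver_eq_filter (cmTypeEquivCMTypeOn K Φ) k hk' r.2, Finset.mem_filter,
    orbitRep_eq_self_of_mem_orbitReps (cmTypeEquivCMTypeOn K Φ) k r'.2] at hmem
  exact hne (Subtype.ext hmem.2.symm)

include hj in
/-- **`Ψ` is stable under `Γ_k`** («`Φ Aut(ℂ/E) … is stable under the left action of `Aut(ℂ/E*)`», for `k ⊇ E*`).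
[cite: Milne2007FundamentalCM, §4.2 («stable under the left action of Aut(ℂ/E*)»)] -/
theorem absGaloisRestrict_smul_preimage_cmType (hk : traceField Φ ≤ k) (δ : absoluteGaloisGroup k) :
    absGaloisRestrict ℚ k δ • (embOfCoset K j ⁻¹' Φ.1) = embOfCoset K j ⁻¹' Φ.1 := by
  rw [preimage_cmType_eq_iUnion_orbit k hj K Φ hk, Set.smul_set_iUnion]
  exact Set.iUnion_congr fun r =>
    smul_orbit_eq (absGaloisRestrict ℚ k).range (⟨absGaloisRestrict ℚ k δ, ⟨δ, rfl⟩⟩ : (absGaloisRestrict ℚ k).range)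

end Embeddings

/-! ### §2. `F_Ψ(res σ) = ∏_r res^ab_{K,M_r}(Ver_{M_r/k}[σ])` -/

section Assembly

variable (K : Type) [Field K] [NumberField K] [IsCMField K] (Φ : CMType K) (k : IntermediateField ℚ ℂ) [NumberField k]
  {j : AlgebraicClosure ℚ →+* ℂ} (hj : ∀ x : k, j (absEmbedding ℚ k x) = (x : ℂ))
  {υ : ℚ →+* ℝ} {c : absoluteGaloisGroup ℚ} (hc : IsComplexConjugation υ c)
  (hjc : ∀ y : AlgebraicClosure ℚ, j (c • y) = starRingEnd ℂ (j y))

include hj hc hjc in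
/-- **`F_Φ(σ) = ∏_j F_j(σ) = ∏_j σ_j⁻¹V(σ)σ_j` IN `Γ_K^ab`: for `σ ∈ Γ_k`,
`F_Ψ(res σ) = ∏_r res^ab_{K,M_r}(Ver_{M_r/k}[σ])`** over p27's orbit representatives `r`, `M_r = k·r(K)` — FILE 1's
`halfTransferWith_eq_prod_transfer` over the decomposition `Ψ = ⊔_r S • g_rH` of §1 (any section computes `F_Ψ` on the
stabiliser `S` of `Ψ`), and FILE 3's `transfer_orbitTransferHom_eq` on each orbit.
[cite: Milne2007FundamentalCM, §4.2 Prop. 4.9 (proof: «∏ F_j(σ) = F_Φ(σ)», «F_j(σ) = σ_j⁻¹V(σ)σ_j»)] -/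
theorem tateHalfTransfer_absGaloisRestrict_eq_prod (hk : traceField Φ ≤ k) (τ : absoluteGaloisGroup k) :
    tateHalfTransfer K c (embOfCoset K j ⁻¹' Φ.1) (absGaloisRestrict ℚ k τ) =
      ∏ r : ↥(orbitReps (cmTypeEquivCMTypeOn K Φ) k),
        absGaloisRestrictAb K (orbitField k (r : Emb K))
          (verlagerung k (orbitField k (r : Emb K)) (absGaloisAbProj k τ)) := by
  have hΨ : IsCMTypeWith c (embOfCoset K j ⁻¹' Φ.1) := isCMTypeWith_preimage_cmType K hc hjc Φ
  have hcc : c * c = 1 := by rw [← pow_two, hc.sq_eq_one]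
  obtain ⟨w, hw⟩ := exists_isSymmSection hcc
    (((1 : absoluteGaloisGroup ℚ)) : absoluteGaloisGroup ℚ ⧸ (absGaloisRestrict ℚ K).range) hΨ
  rw [tateHalfTransfer, halfTransfer_eq_halfTransferWith_of_smul_eq (absGaloisRangeAbProj ℚ K)
      (mem_iff_smul_quotient_one_eq (H := (absGaloisRestrict ℚ K).range)) hΨ ⟨w, hw⟩
      (absGaloisRestrict_smul_preimage_cmType k hj K Φ hk τ) hw.smul_base,
    halfTransferWith_eq_prod_transfer (absGaloisRangeAbProj ℚ K)
      (mem_iff_smul_quotient_one_eq (H := (absGaloisRestrict ℚ K).range)) (absGaloisRestrict ℚ k).range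
      (fun r : ↥(orbitReps (cmTypeEquivCMTypeOn K Φ) k) => orbitGaloisRep_smul_one K k (r : Emb K))
      (preimage_cmType_eq_iUnion_orbit k hj K Φ hk) (pairwise_disjoint_orbit k hj K Φ hk) hw.smul_base
      ⟨absGaloisRestrict ℚ k τ, ⟨τ, rfl⟩⟩]
  exact Finset.prod_congr rfl fun r _ => transfer_orbitTransferHom_eq K k (r : Emb K) τ

end Assembly

/-! ### §3. `∏_r res^ab_{K,M_r} ∘ Ver_{M_r/k}` is Milne's `η` (Lemma 9.8): `art_E(b_j) = (res ∘ ad σ_j⁻¹ ∘ V)(art_{E*}(a))` -/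

section Eta

variable (K : Type) [Field K] [NumberField K] (Φ : CMType K) (k : IntermediateField ℚ ℂ)

/-- **`∏_r res^ab_{K,M_r} ∘ Ver_{M_r/k} : Γ_k^ab → Γ_K^ab`** — the product over the orbits of the bottom rows
«`V`, `ad σ_j⁻¹`, restriction» of Milne's diagrams, a homomorphism defined on the Galois side alone.
[cite: Milne2007FundamentalCM, §4.2 Prop. 4.9 (proof: the bottom row of the diagram)] -/
def orbitVerlagerungProd : absoluteGaloisGroupAbelianization k →* absoluteGaloisGroupAbelianization K :=
  ∏ r : ↥(orbitReps (cmTypeEquivCMTypeOn K Φ) k),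
    (absGaloisRestrictAb K (orbitField k (r : Emb K))).toMonoidHom.comp (verlagerung k (orbitField k (r : Emb K))).toMonoidHom

/-- Unfolding. [cite: Milne2007FundamentalCM, §4.2 Prop. 4.9 (proof)] -/
theorem orbitVerlagerungProd_apply (x : absoluteGaloisGroupAbelianization k) :
    orbitVerlagerungProd K Φ k x = ∏ r : ↥(orbitReps (cmTypeEquivCMTypeOn K Φ) k),
      absGaloisRestrictAb K (orbitField k (r : Emb K)) (verlagerung k (orbitField k (r : Emb K)) x) := by
  rw [orbitVerlagerungProd, MonoidHom.finsetProd_apply]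
  rfl

variable [NumberField k]

/-- **«`art_E(b_j)` is the image of `art_{E*}(a)` by the three maps in the bottom row» and «`N_Φ(a) = ∏ b_j`»: on `[x, k]`,
`∏_r res^ab_r(Ver_r [x, k]) = ∏_r [Nm_{M_r/K}(con_{M_r/k} x), K] = [N_{k,Φ}(x), K]`** (A3-G44 `verlagerung_ideleArtinMap`, A3-G39
`absGaloisRestrictAb_ideleArtinMap`, FILE 2 `reflexNormIdele_eq_prod_ideleRelNorm_orbitField`).
[cite: Milne2007FundamentalCM, §4.2 Prop. 4.9 (proof: «The basic properties of Artin's reciprocity law show that [the diagram] commutes», «art_E(N_Φ(a)) = ∏ art_E(b_j)»)]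
[cite: NeukirchANT1999, Ch. IV §5 (5.8), (5.9); Ch. VI §5 (5.2)] -/
theorem orbitVerlagerungProd_ideleArtinMap (x : ideleGroup k) :
    orbitVerlagerungProd K Φ k (ideleArtinMap k x) = ideleArtinMap K (reflexNormIdele K Φ k x) := by
  rw [orbitVerlagerungProd_apply, reflexNormIdele_eq_prod_ideleRelNorm_orbitField K Φ k x, map_prod]
  refine Finset.prod_congr rfl fun r _ => ?_
  rw [verlagerung_ideleArtinMap, absGaloisRestrictAb_ideleArtinMap]

/-- **`∏_r res^ab_{K,M_r} ∘ Ver_{M_r/k} = η_{k,Φ}`**, Milne's homomorphism of Lemma 9.8 (row A3-G39 `reflexNormArtinHom`; by its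
uniqueness `eq_reflexNormArtinHom`). [cite: Milne2007FundamentalCM, §4.2 Prop. 4.9 (proof)] [cite: MilneCM2006, Ch. II §9 Lemma 9.8] -/
theorem orbitVerlagerungProd_eq_reflexNormArtinHom : orbitVerlagerungProd K Φ k = reflexNormArtinHom K Φ k :=
  eq_reflexNormArtinHom K Φ k (orbitVerlagerungProd_ideleArtinMap K Φ k)

end Eta

/-! ### §4. THE THEOREM: `F_Ψ ∘ res = η_{k,Φ}` on `Γ_k`; `art_E(N_Φ(a)) = F_Φ(σ)` -/

section Main

variable (K : Type) [Field K] [NumberField K] [IsCMField K] (Φ : CMType K) (k : IntermediateField ℚ ℂ) [NumberField k]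
  {j : AlgebraicClosure ℚ →+* ℂ} (hj : ∀ x : k, j (absEmbedding ℚ k x) = (x : ℂ))
  {υ : ℚ →+* ℝ} {c : absoluteGaloisGroup ℚ} (hc : IsComplexConjugation υ c)
  (hjc : ∀ y : AlgebraicClosure ℚ, j (c • y) = starRingEnd ℂ (j y))

include hj hc hjc

/-- **THEOREM (Milne 2007, proof of Prop. 4.9): `F_Ψ(res σ) = η_{k,Φ}[σ]` for every `σ ∈ Γ_k`, `k ⊇ E*`.**  Tate's half transfer
`F_Ψ : Γ_ℚ → Γ_K^ab` of the CM type `Ψ = Θ⁻¹(Φ)` (row A3-G45), restricted to `Γ_k`, is the reciprocity homomorphism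
`η_{k,Φ} : Γ_k^ab → Γ_K^ab` of the reflex norm `N_{k,Φ}` (row A3-G39, Milne CM Lemma 9.8: `η [s, k] = [N_{k,Φ} s, K]`) — §2 and §3.
For `k = E*` this is «`art_E(N_Φ(a)) = F_Φ(σ)`» for all `a` with `art_{E*}(a) = σ|E*^ab`.
[cite: Milne2007FundamentalCM, §4.2 Prop. 4.9 (proof: «Thus art_E(N_Φ(a)) = ∏ art_E(b_j) = ∏ F_j(σ) = F_Φ(σ)»)] -/
theorem tateHalfTransfer_absGaloisRestrict (hk : traceField Φ ≤ k) (τ : absoluteGaloisGroup k) :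
    tateHalfTransfer K c (embOfCoset K j ⁻¹' Φ.1) (absGaloisRestrict ℚ k τ) = reflexNormArtinHom K Φ k (absGaloisAbProj k τ) := by
  rw [tateHalfTransfer_absGaloisRestrict_eq_prod K Φ k hj hc hjc hk τ, ← orbitVerlagerungProd_apply,
    orbitVerlagerungProd_eq_reflexNormArtinHom]

/-- **`art_E(N_Φ(a)) = F_Φ(σ)` — the idelic form**: if `σ ∈ Γ_k` lifts `[s, k]` (`s ∈ 𝕀_k`, `k ⊇ E*`), then
`[N_{k,Φ}(s), K] = F_Ψ(res σ)` in `Γ_K^ab` (the tree's `[·, F] = art_F⁻¹` on both sides: Milne's `art_{E*}(a) = σ` reads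
`[a, E*] = [σ⁻¹]`, and `art_E(N_Φ(a)) = F_Φ(σ)` reads `[N_Φ(a), E] = F_Φ(σ)⁻¹ = F_Φ(σ⁻¹)` — the present statement at `σ⁻¹`).
[cite: Milne2007FundamentalCM, §4.2 Prop. 4.9 (proof: «Thus art_E(N_Φ(a)) = … = F_Φ(σ)»)] -/
theorem ideleArtinMap_reflexNormIdele_eq_tateHalfTransfer (hk : traceField Φ ≤ k) {τ : absoluteGaloisGroup k}
    {s : ideleGroup k} (hs : absGaloisAbProj k τ = ideleArtinMap k s) :
    ideleArtinMap K (reflexNormIdele K Φ k s) = tateHalfTransfer K c (embOfCoset K j ⁻¹' Φ.1) (absGaloisRestrict ℚ k τ) := by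
  rw [tateHalfTransfer_absGaloisRestrict K Φ k hj hc hjc hk τ, hs, reflexNormArtinHom_ideleArtinMap]

/-- **`F_Ψ ∘ res_ℚ^k` IS A HOMOMORPHISM FACTORING THROUGH `Γ_k^ab`** (a consequence: it is `η_{k,Φ} ∘ [·]`); in
particular `F_Ψ(res(στ)) = F_Ψ(res σ)·F_Ψ(res τ)` — the multiplicativity of `F_Φ` on `Aut(ℂ/E*)` (Prop. 4.8 (a) with `τΦ = Φ`)
recovered. [cite: Milne2007FundamentalCM, §4.2 Prop. 4.8 (a), Prop. 4.9] -/
theorem tateHalfTransfer_absGaloisRestrict_mul (hk : traceField Φ ≤ k) (σ τ : absoluteGaloisGroup k) :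
    tateHalfTransfer K c (embOfCoset K j ⁻¹' Φ.1) (absGaloisRestrict ℚ k (σ * τ)) =
      tateHalfTransfer K c (embOfCoset K j ⁻¹' Φ.1) (absGaloisRestrict ℚ k σ) *
        tateHalfTransfer K c (embOfCoset K j ⁻¹' Φ.1) (absGaloisRestrict ℚ k τ) := by
  rw [tateHalfTransfer_absGaloisRestrict K Φ k hj hc hjc hk, tateHalfTransfer_absGaloisRestrict K Φ k hj hc hjc hk,
    tateHalfTransfer_absGaloisRestrict K Φ k hj hc hjc hk, map_mul, map_mul]

/-- `F_Ψ(res σ⁻¹) = F_Ψ(res σ)⁻¹` for `σ ∈ Γ_k`. [cite: Milne2007FundamentalCM, §4.2 Prop. 4.8 (a), Prop. 4.9] -/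
theorem tateHalfTransfer_absGaloisRestrict_inv (hk : traceField Φ ≤ k) (τ : absoluteGaloisGroup k) :
    tateHalfTransfer K c (embOfCoset K j ⁻¹' Φ.1) (absGaloisRestrict ℚ k τ⁻¹) =
      (tateHalfTransfer K c (embOfCoset K j ⁻¹' Φ.1) (absGaloisRestrict ℚ k τ))⁻¹ := by
  rw [tateHalfTransfer_absGaloisRestrict K Φ k hj hc hjc hk, tateHalfTransfer_absGaloisRestrict K Φ k hj hc hjc hk,
    map_inv, map_inv]

end Main

end Literature.NumberTheory.ComplexMultiplication

end
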